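import Summits.HodgeConjecture.HodgeConjecture.Theorems.K2E4ExplicitArchSingularTransferDefs   -- ★ p855024 (K2E4-p09): `GPrimeData` (the target structure) and the letters' archimedean vocabulary
import Literature.NumberTheory.Rogawski1990.ArchStableOrbitalWallStepOrbitMeasure               -- ★ (R1-e′): the wall orbit measures' vocabulary (`quotientMeasure`, `descConj`, relabelled groups)
import HarnessLib

/-!
# `K2E4ArchGPrimeDefs` — the objects of the `G′`-PACKAGE (K2E4-p11 for the #9 assembly): the wall point, the 2-block data, the wall ∕ state measures and the κ-weighted
# `G′`-state family `B(S, u)` of the endoscopic singular transfer at `∞` (Rogawski 1990 Prop. 8.2.1 (a) pp. 118–119, §8.2 pp. 122–124, §4.3 (4.3.1) p. 43)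

Track B ∕ K2-LIT, crux h413 = `stmt-HodgeConjecture-24833`; prover seat `hodgecm-mathlib-K2E4-p11` (g0), V2 «G′ PACKAGE» for the assembler K2E4-p09 (chair ruling R-13a).  DEFINITIONS
ONLY (plain `def`s of DATA — points, measures, a number; no `Prop`-valued def, no structure, no instance, no notation, no `sorry`).  The property files
(`K2E4ArchGPrimeReg` (reg), `K2E4ArchGPrimeStep` (step), `K2E4ArchGPrimeEnd` (end)) and the packer `K2E4ArchGPrimeData` (`Nonempty (GPrimeData …)`) read these names.
All measures entering the state are PARAMETERS (`νw` per-place Haar measures on the `G_v(α)`, `νH` reference centraliser measures on the relabelled groups `G_w(α∘τ)` at the wall point,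
`χ` the Haar scalar of the global measure, `Θ` the ambient lift of the test function): the packer instantiates them (Borel σ-algebras, the `(−1)`-pinned references of ★
`exists_centralizer_measure_clause_neg_one`, `χ = haarScalarFactor`, `Θ` from ★ `ArchSmooth.exists_contDiff`).
* `embCircle L e h w` — `σ_w(e) ∈ 𝕊¹` for `c(e)·e = 1` (the token of ★ `GPrimeData` spelled once); `wallPoint` — `z⁰_w = (σ_w e₁, σ_w e₂, σ_w e₁)` (slots `0 = 2`, the (U) road's wall
  normal form); `twoBlock S u` — the 2-block datum frozen to the centre `(σe₁, σe₁)` on the processed places `S`; `datum S u = (twoBlock₀, σe₂, twoBlock₁)`.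
* `singularWallMeasure` — ★ (R1-e′)'s singular orbit measure of the NONCOMPACT partner `τ` at `w` (Weil quotient of the transported Haar measure by the reference measure `νH w τ⁻¹` on
  `G_w(α∘τ⁻¹)`, pushed along the descended orbit map of `diag z⁰_w` and relabelled back to `G_w(α)`) — the token of ★ G3-step `K2E4ArchGStateStep.tendsto_deriv_gState_step`'s `hℓn`;
  `wallMeasure` — `(cw_w τ ? ν_w.map conj_{diag(z⁰_w∘τ)} : singularWallMeasure)`; `stateMeasure S u ρ v` — wall measure on `S`, regular orbit measure of `diag(datum_v∘ρ_v)` off `S`.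
* `wallCoef w τ = (cw_w τ ? 2 : −1)` — the jump coefficients for the `(−1)`-PINNED references (print's `c` and `−c`, [§8.2 p. 118, p. 123]); `relabelMultiplicity` — `#{τ ∣ ∀ v, τ_v(P_v) = P_v}`.
* **`gState … S u`** — `B(S, u) = Σ_{ρ : W → S₃} χ·N⁻¹·T′.Δ(γ_H[S,u], t(datum S u ∘ ρ))·(∏_{v∈S} wallCoef_v(ρ_v))·∫ Θ ↑↑(e⁻¹ o) d(⊗_v stateMeasure S u ρ v)`, `γ_H[S,u] = (Ψ_{Q₂}⁻¹ t₂(twoBlock S u), e₁⁻¹ diag(σe₂))`.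
HONEST LABEL: HC_CM is proved only modulo the 7 printed citations (2 remaining named inputs: hLiu418 = `stmt-HodgeConjecture-24832`, h413 = `stmt-HodgeConjecture-24833`) until rung 0
closes; these are definitions, they assert nothing.

## References
* [Rogawski1990] J. D. Rogawski, *Automorphic Representations of Unitary Groups in Three Variables*, Ann. of Math. Stud. 123 (1990): §8.2 Prop. 8.2.1 (a) pp. 118–119, pp. 122–124;
  §4.3 (4.3.1) p. 43; §14.5 Lemma 14.5.2 (b) pp. 238–239.
* [DeitmarEchterhoff2014] A. Deitmar, S. Echterhoff, *Principles of Harmonic Analysis*, 2nd ed. (2014), Thm. 1.5.3 (Weil quotient measures).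
-/

set_option autoImplicit false
-- the mandated namespace repeats the single-problem summit's segment (`HodgeConjecture.HodgeConjecture`)
set_option linter.dupNamespace false

noncomputable section

open MeasureTheory Measure NumberField NumberField.InfinitePlace NumberField.mixedEmbedding Filter Topology Set Equiv
open Literature.MeasureTheory.Group Literature.NumberTheory.Rogawski1990 Literature.NumberTheory.Automorphic Literature.NumberTheory.Automorphic.UnitaryGroup
open Literature.LinearAlgebra.Matrix
open scoped Matrix MatrixGroups Matrix.Norms.Operator ContDiff Classical ENNReal

namespace Summit.HodgeConjecture.HodgeConjecture.Cruxes.H413.K2E4ArchGPrimeDefs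

variable (L : Type) [Field L] [NumberField L] [IsCMField L]

/-! ## §1 Points -/

/-- `σ_w(e) ∈ 𝕊¹` for `e ∈ L` with `c(e)·e = 1` — the circle token of ★ `GPrimeData`. [cite: Rogawski1990, §8.2 p. 118] -/
abbrev embCircle (e : L) (h : (IsCMField.complexConj L e : L) * e = 1) (w : {w : InfinitePlace L // IsComplex w}) : Circle :=
  ⟨w.1.embedding e, mem_sphere_zero_iff_norm.mpr (UnitaryGroup.norm_embedding_eq_one_of_complexConj_mul_self L e h w)⟩

/-- The wall point `z⁰_w = (σ_w e₁, σ_w e₂, σ_w e₁)` (slots `0` and `2` coincide — the (U) road's normal form of the wall). [cite: Rogawski1990, §8.2 p. 118 (`γ₀`)] -/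
abbrev wallPoint (e₁ e₂ : L) (h₁ : (IsCMField.complexConj L e₁ : L) * e₁ = 1) (h₂ : (IsCMField.complexConj L e₂ : L) * e₂ = 1)
    (w : {w : InfinitePlace L // IsComplex w}) : Fin 3 → Circle :=
  ![embCircle L e₁ h₁ w, embCircle L e₂ h₂ w, embCircle L e₁ h₁ w]

/-- Slots `0` and `2` of the wall point agree. [cite: Rogawski1990, §8.2 p. 118] -/
theorem wallPoint_zero_eq_two (e₁ e₂ : L) (h₁ : (IsCMField.complexConj L e₁ : L) * e₁ = 1) (h₂ : (IsCMField.complexConj L e₂ : L) * e₂ = 1)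
    (w : {w : InfinitePlace L // IsComplex w}) : wallPoint L e₁ e₂ h₁ h₂ w 0 = wallPoint L e₁ e₂ h₁ h₂ w 2 := rfl

/-- Slots `0` and `1` of the wall point differ when `e₁ ≠ e₂` (the embedding `σ_w` is injective). [cite: Rogawski1990, §8.2 p. 118] -/
theorem wallPoint_zero_ne_one (e₁ e₂ : L) (h₁ : (IsCMField.complexConj L e₁ : L) * e₁ = 1) (h₂ : (IsCMField.complexConj L e₂ : L) * e₂ = 1) (hne : e₁ ≠ e₂)
    (w : {w : InfinitePlace L // IsComplex w}) : wallPoint L e₁ e₂ h₁ h₂ w 0 ≠ wallPoint L e₁ e₂ h₁ h₂ w 1 :=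
  fun h => hne (w.1.embedding.injective (congrArg (fun z : Circle => (z : ℂ)) h))

/-- The 2-block datum with the processed places `S` frozen to the centre `(σe₁, σe₁)`. [cite: Rogawski1990, §14.5 p. 238 (place by place)] -/
def twoBlock (e₁ : L) (h₁ : (IsCMField.complexConj L e₁ : L) * e₁ = 1) (S : Finset {w : InfinitePlace L // IsComplex w})
    (u : {w : InfinitePlace L // IsComplex w} → Fin 2 → Circle) : {w : InfinitePlace L // IsComplex w} → Fin 2 → Circle :=
  fun v => if v ∈ S then ![embCircle L e₁ h₁ v, embCircle L e₁ h₁ v] else u v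

/-- The torus datum `(twoBlock₀, σe₂, twoBlock₁)` of `U(diag α)_∞` — slot `1` carries the `U(Φ₁)`-eigenvalue. [cite: Rogawski1990, §8.2 p. 122] -/
abbrev datum (e₁ e₂ : L) (h₁ : (IsCMField.complexConj L e₁ : L) * e₁ = 1) (h₂ : (IsCMField.complexConj L e₂ : L) * e₂ = 1) (S : Finset {w : InfinitePlace L // IsComplex w})
    (u : {w : InfinitePlace L // IsComplex w} → Fin 2 → Circle) : {w : InfinitePlace L // IsComplex w} → Fin 3 → Circle :=
  fun v => ![twoBlock L e₁ h₁ S u v 0, embCircle L e₂ h₂ v, twoBlock L e₁ h₁ S u v 1]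

/-! ## §2 Measures -/

variable (α : Fin 3 → L) [MeasurableSpace (GL (Fin 3) ℂ)] [BorelSpace (GL (Fin 3) ℂ)]
  (νw : ∀ v : {w : InfinitePlace L // IsComplex w}, Measure (archLocal L 3 (Matrix.diagonal α) v)) (hνw : ∀ v, (νw v).IsHaarMeasure ∧ (νw v).IsMulRightInvariant)
  (e₁ e₂ : L) (h₁ : (IsCMField.complexConj L e₁ : L) * e₁ = 1) (h₂ : (IsCMField.complexConj L e₂ : L) * e₂ = 1) (hne : e₁ ≠ e₂)
  [∀ (w : {w : InfinitePlace L // IsComplex w}) (τ : Perm (Fin 3)), MeasurableSpace (archLocal L 3 (Matrix.diagonal (α ∘ ⇑τ)) w ⧸ Subgroup.centralizer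
    ({(⟨circleDiagonal 3 (wallPoint L e₁ e₂ h₁ h₂ w), circleDiagonal_mem_archLocal_diagonal L 3 (α ∘ ⇑τ) w (wallPoint L e₁ e₂ h₁ h₂ w)⟩ : archLocal L 3 (Matrix.diagonal (α ∘ ⇑τ)) w)} :
      Set (archLocal L 3 (Matrix.diagonal (α ∘ ⇑τ)) w)))]
  [∀ (w : {w : InfinitePlace L // IsComplex w}) (τ : Perm (Fin 3)), BorelSpace (archLocal L 3 (Matrix.diagonal (α ∘ ⇑τ)) w ⧸ Subgroup.centralizer
    ({(⟨circleDiagonal 3 (wallPoint L e₁ e₂ h₁ h₂ w), circleDiagonal_mem_archLocal_diagonal L 3 (α ∘ ⇑τ) w (wallPoint L e₁ e₂ h₁ h₂ w)⟩ : archLocal L 3 (Matrix.diagonal (α ∘ ⇑τ)) w)} :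
      Set (archLocal L 3 (Matrix.diagonal (α ∘ ⇑τ)) w)))]
  (νH : ∀ (w : {w : InfinitePlace L // IsComplex w}) (τ : Perm (Fin 3)), Measure (Subgroup.centralizer
    ({(⟨circleDiagonal 3 (wallPoint L e₁ e₂ h₁ h₂ w), circleDiagonal_mem_archLocal_diagonal L 3 (α ∘ ⇑τ) w (wallPoint L e₁ e₂ h₁ h₂ w)⟩ : archLocal L 3 (Matrix.diagonal (α ∘ ⇑τ)) w)} :
      Set (archLocal L 3 (Matrix.diagonal (α ∘ ⇑τ)) w))))
  (hνH : ∀ w τ, (νH w τ).IsHaarMeasure ∧ (νH w τ).IsInvInvariant)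

/-- **The singular orbit measure of the NONCOMPACT partner `τ` at `w`** (★ (R1-e′)'s, the token of ★ G3-step's `hℓn`): the Weil quotient of the transported Haar measure
`ν_w.map e_{τ⁻¹}⁻¹` on `G_w(α∘τ⁻¹)` by the reference measure `νH w τ⁻¹` on the wall centraliser `Z(diag z⁰_w)`, pushed forward along the descended orbit map of `diag z⁰_w` and
relabelled back to `G_w(α)`. [cite: Rogawski1990, §8.2 p. 119 (`f^H(γ₀)`), p. 124] [cite: DeitmarEchterhoff2014, Thm. 1.5.3] -/
def singularWallMeasure (w : {w : InfinitePlace L // IsComplex w}) (τ : Perm (Fin 3)) : Measure (archLocal L 3 (Matrix.diagonal α) w) :=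
  haveI : LocallyCompactSpace (archLocal L 3 (Matrix.diagonal (α ∘ ⇑τ⁻¹)) w) := locallyCompactSpace_archLocal L 3 (Matrix.diagonal (α ∘ ⇑τ⁻¹)) w
  haveI : SecondCountableTopology (archLocal L 3 (Matrix.diagonal (α ∘ ⇑τ⁻¹)) w) := secondCountableTopology_archLocal L 3 (Matrix.diagonal (α ∘ ⇑τ⁻¹)) w
  haveI : (νH w τ⁻¹).IsHaarMeasure := (hνH w τ⁻¹).1
  haveI : (νH w τ⁻¹).IsInvInvariant := (hνH w τ⁻¹).2
  haveI : (νw w).IsHaarMeasure := (hνw w).1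
  haveI : (νw w).IsMulRightInvariant := (hνw w).2
  haveI : ((νw w).map (ContinuousMulEquiv.restrictSubgroup (GLn.conjEquiv (Matrix.GeneralLinearGroup.mkOfDetNeZero _ (det_monomial_one_ne_zero 3 τ⁻¹)))
      (archLocal L 3 (Matrix.diagonal (α ∘ ⇑τ⁻¹)) w) (archLocal L 3 (Matrix.diagonal α) w)
      (mem_archLocal_comp_perm_iff_conj_mem L 3 α w τ⁻¹)).symm).IsHaarMeasure := ContinuousMulEquiv.isHaarMeasure_map (νw w) _
  haveI : ((νw w).map (ContinuousMulEquiv.restrictSubgroup (GLn.conjEquiv (Matrix.GeneralLinearGroup.mkOfDetNeZero _ (det_monomial_one_ne_zero 3 τ⁻¹)))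
      (archLocal L 3 (Matrix.diagonal (α ∘ ⇑τ⁻¹)) w) (archLocal L 3 (Matrix.diagonal α) w)
      (mem_archLocal_comp_perm_iff_conj_mem L 3 α w τ⁻¹)).symm).IsMulRightInvariant := isMulRightInvariant_map_relabel_symm L 3 α w τ⁻¹ (νw w)
  ((quotientMeasure _ (νH w τ⁻¹) (isClosed_coe_centralizer_singleton _)
      ((νw w).map (ContinuousMulEquiv.restrictSubgroup (GLn.conjEquiv (Matrix.GeneralLinearGroup.mkOfDetNeZero _ (det_monomial_one_ne_zero 3 τ⁻¹)))
        (archLocal L 3 (Matrix.diagonal (α ∘ ⇑τ⁻¹)) w) (archLocal L 3 (Matrix.diagonal α) w)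
        (mem_archLocal_comp_perm_iff_conj_mem L 3 α w τ⁻¹)).symm)).map
    (descConj (⟨circleDiagonal 3 (wallPoint L e₁ e₂ h₁ h₂ w), circleDiagonal_mem_archLocal_diagonal L 3 (α ∘ ⇑τ⁻¹) w (wallPoint L e₁ e₂ h₁ h₂ w)⟩ :
        archLocal L 3 (Matrix.diagonal (α ∘ ⇑τ⁻¹)) w)
      (Subgroup.centralizer ({(⟨circleDiagonal 3 (wallPoint L e₁ e₂ h₁ h₂ w), circleDiagonal_mem_archLocal_diagonal L 3 (α ∘ ⇑τ⁻¹) w (wallPoint L e₁ e₂ h₁ h₂ w)⟩ :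
        archLocal L 3 (Matrix.diagonal (α ∘ ⇑τ⁻¹)) w)} : Set (archLocal L 3 (Matrix.diagonal (α ∘ ⇑τ⁻¹)) w)))
      (forall_mem_centralizer_circleDiagonal_comm_of_wall L (α ∘ ⇑τ⁻¹) w (wallPoint_zero_eq_two L e₁ e₂ h₁ h₂ w) (wallPoint_zero_ne_one L e₁ e₂ h₁ h₂ hne w)
        (wallPoint_zero_eq_two L e₁ e₂ h₁ h₂ w) (wallPoint_zero_ne_one L e₁ e₂ h₁ h₂ hne w)) id)).map
    (ContinuousMulEquiv.restrictSubgroup (GLn.conjEquiv (Matrix.GeneralLinearGroup.mkOfDetNeZero _ (det_monomial_one_ne_zero 3 τ⁻¹)))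
      (archLocal L 3 (Matrix.diagonal (α ∘ ⇑τ⁻¹)) w) (archLocal L 3 (Matrix.diagonal α) w)
      (mem_archLocal_comp_perm_iff_conj_mem L 3 α w τ⁻¹))

/-- **The wall measure of the partner `τ` at `w`**: the (finite) orbit measure `ν_w.map conj_{diag(z⁰_w∘τ)}` if the `w`-wall of `τ` is COMPACT (`re σ_w α_{τ⁻¹0} · re σ_w α_{τ⁻¹2} > 0`,
centraliser `U(2) × U(1)`), the singular orbit measure otherwise. [cite: Rogawski1990, §8.2 pp. 122–124] -/
def wallMeasure (w : {w : InfinitePlace L // IsComplex w}) (τ : Perm (Fin 3)) : Measure (archLocal L 3 (Matrix.diagonal α) w) :=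
  if 0 < (w.1.embedding (α (τ⁻¹ 0))).re * (w.1.embedding (α (τ⁻¹ 2))).re then
    (νw w).map fun y : archLocal L 3 (Matrix.diagonal α) w =>
      y * (⟨circleDiagonal 3 (wallPoint L e₁ e₂ h₁ h₂ w ∘ ⇑τ), circleDiagonal_mem_archLocal_diagonal L 3 α w (wallPoint L e₁ e₂ h₁ h₂ w ∘ ⇑τ)⟩ : archLocal L 3 (Matrix.diagonal α) w) * y⁻¹
  else singularWallMeasure L α νw hνw e₁ e₂ h₁ h₂ hne νH hνH w τ

/-- **The state measure at the place `v`** for the processed places `S`, the 2-block datum `u` and the relabelling family `ρ`: the wall measure on `S`, the regular orbit measure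
`ν_v.map conj_{diag(datum_v ∘ ρ_v)}` off `S`. [cite: Rogawski1990, §14.5 p. 238; §8.2 p. 124] -/
def stateMeasure (S : Finset {w : InfinitePlace L // IsComplex w}) (u : {w : InfinitePlace L // IsComplex w} → Fin 2 → Circle)
    (ρ : {w : InfinitePlace L // IsComplex w} → Perm (Fin 3)) (v : {w : InfinitePlace L // IsComplex w}) : Measure (archLocal L 3 (Matrix.diagonal α) v) :=
  if v ∈ S then wallMeasure L α νw hνw e₁ e₂ h₁ h₂ hne νH hνH v (ρ v)
  else (νw v).map fun y : archLocal L 3 (Matrix.diagonal α) v =>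
    y * (⟨circleDiagonal 3 (datum L e₁ e₂ h₁ h₂ S u v ∘ ⇑(ρ v)), circleDiagonal_mem_archLocal_diagonal L 3 α v (datum L e₁ e₂ h₁ h₂ S u v ∘ ⇑(ρ v))⟩ : archLocal L 3 (Matrix.diagonal α) v) * y⁻¹

/-! ## §3 Coefficients and the state -/

omit [NumberField L] in
/-- **The jump coefficient of the partner `τ` at `w` for the `(−1)`-PINNED references**: `2` at a compact wall (print's `c`, probability mass on `U(2) × U(1)`), `−1` at a
noncompact wall (print's `−c`: «the constant in the limit formula for `H′` differs by a sign»). [cite: Rogawski1990, §8.2 p. 118; p. 123] -/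
def wallCoef (w : {w : InfinitePlace L // IsComplex w}) (τ : Perm (Fin 3)) : ℂ :=
  if 0 < (w.1.embedding (α (τ⁻¹ 0))).re * (w.1.embedding (α (τ⁻¹ 2))).re then 2 else -1

omit [NumberField L] in
/-- **The relabelling multiplicity** `N = #{τ : W → S₃ ∣ ∀ v, τ_v(P_v) = P_v}`, `P_v = {i ∣ re σ_v α_i > 0}` — the number of relabellings of a `G`-regular torus datum in one `G_∞`-class
(★ `card_filter_mk_relabel_eq_of_injective` + ★ `card_filter_forall_image_eq`). [cite: Rogawski1990, §4.1 (4.1.1) p. 39] -/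
def relabelMultiplicity : ℕ :=
  (Finset.univ.filter fun τ : {w : InfinitePlace L // IsComplex w} → Perm (Fin 3) => ∀ v : {w : InfinitePlace L // IsComplex w},
    (Finset.univ.filter fun i : Fin 3 => 0 < (v.1.embedding (α i)).re).image ⇑(τ v) = (Finset.univ.filter fun i : Fin 3 => 0 < (v.1.embedding (α i)).re)).card

variable [MeasurableSpace (arch (↥(maximalRealSubfield L)) L (IsCMField.complexConj L) 3 (Matrix.diagonal α))]
  [BorelSpace (arch (↥(maximalRealSubfield L)) L (IsCMField.complexConj L) 3 (Matrix.diagonal α))]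

/-- **THE κ-WEIGHTED `G′`-STATE `B(S, u)`** of the endoscopic singular transfer at `∞` (the `family` of ★ `GPrimeData`, for the ambient lift `Θ` of the test function, the Haar scalar
`χ` and the transfer factor `T′`): `Σ_ρ χ·N⁻¹·T′.Δ(γ_H[S,u], t(datum S u ∘ ρ))·(∏_{v∈S} wallCoef_v(ρ_v))·∫ Θ ↑↑(e⁻¹ o) d(⊗_v stateMeasure S u ρ v)` with the `H_∞`-point
`γ_H[S,u] = (Ψ_{Q₂}⁻¹ t₂(twoBlock S u), e₁⁻¹ diag(σe₂))`.  At `S = ∅` this is the `Δ′`-weighted Haar class sum of (4.3.1) at the `G`-regular datum (★ `K2E4ArchGStateReg`); each step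
`S ↦ S ∪ {w}` is the wall jump at `w` (★ `K2E4ArchGStateStep`); at `S = univ` it is a multiple of `Φ^{st}_∞(t z⁰, ·)`. [cite: Rogawski1990, §8.2 Prop. 8.2.1 (a) pp. 118–119; §14.5 p. 238; §4.3 (4.3.1) p. 43] -/
def gState (T' : ArchTransferFactor L (Matrix.diagonal α)) (χ : ℝ≥0∞) (Θ : Matrix (Fin 3) (Fin 3) (mixedSpace L) → ℂ)
    (S : Finset {w : InfinitePlace L // IsComplex w}) (u : {w : InfinitePlace L // IsComplex w} → Fin 2 → Circle) : ℂ :=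
  ∑ ρ : {w : InfinitePlace L // IsComplex w} → Perm (Fin 3),
    (χ.toReal : ℂ) * ((relabelMultiplicity L α : ℕ) : ℂ)⁻¹ *
      T'.Δ ((unitaryGroupOfFormCongrOfEq (UnitaryGroup.conjMixed (↥(maximalRealSubfield L)) L (IsCMField.complexConj L))
              (Matrix.GeneralLinearGroup.map (mixedEmbedding L) (Matrix.GeneralLinearGroup.mkOfDetNeZero !![(1 : L), 1; 1, -1] (UnitaryGroup.det_quasiSplitFrameTwo_ne_zero L)))
              (UnitaryGroup.archFormOf L 2 (Matrix.diagonal ![(2 : L)⁻¹, -(2 : L)⁻¹])) (UnitaryGroup.archFormOf L 2 (Matrix.of fun i j : Fin 2 => if i.val + j.val + 1 = 2 then (1 : L) else 0))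
              (UnitaryGroup.formCongr_map_mixedEmbedding_archFormOf_eq L (UnitaryGroup.formCongr_quasiSplitFrameTwo_diagonal L))).symm
              (UnitaryGroup.archDiagTorus L 2 ![(2 : L)⁻¹, -(2 : L)⁻¹] (twoBlock L e₁ h₁ S u)),
            (UnitaryGroup.archPiEquivCM 1 L (Matrix.of fun i j : Fin 1 => if i.val + j.val + 1 = 1 then (1 : L) else 0)).symm fun w =>
              ⟨UnitaryGroup.circleDiagonal 1 ![embCircle L e₂ h₂ w], UnitaryGroup.circleDiagonal_mem_archLocal_antidiagOne L w _⟩)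
          (UnitaryGroup.archDiagTorus L 3 α fun v => datum L e₁ e₂ h₁ h₂ S u v ∘ ⇑(ρ v)) *
      (∏ v ∈ S, wallCoef L α v (ρ v)) *
      ∫ o, Θ ((((archPiEquivCM 3 L (Matrix.diagonal α)).symm o : arch (↥(maximalRealSubfield L)) L (IsCMField.complexConj L) 3 (Matrix.diagonal α)) :
          GL (Fin 3) (mixedSpace L)) : Matrix (Fin 3) (Fin 3) (mixedSpace L))
        ∂(Measure.pi (stateMeasure L α νw hνw e₁ e₂ h₁ h₂ hne νH hνH S u ρ))

end Summit.HodgeConjecture.HodgeConjecture.Cruxes.H413.K2E4ArchGPrimeDefs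

end
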